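import Summits.ABC.IUTFork.Repair.RH2SigmaHullSigmaBinderRefute
import Summits.ABC.IUTFork.Repair.RHLinearReachLawMixedAbc
import HarnessLib

/-!
# R-H ROUND 2, Q2 «S restricted to Σ», row 20′ `HStarReachMix` — the Σ-BINDER of the window-shape re-cut abc-end (p477961) is KERNEL-FALSE:
# every genuine Θ-volume datum over the tier-1 Frey–Legendre point `(ratPoint λ, 13)`, `λ = 2·5¹⁰·13⁴/(11⁸·109²·3677³)`, lies OFF Σ₂₀′ — no hypothesis, no parameter

PROOF-ONLY file (D-0012: 0 definitions, 0 `Prop` facts, no instance, no notation; abc-iut cell, rung LADDER-ABC:A2.RESCUE.H; seat abc-iut-rp-m1 gen 8, filed on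
abc-iut-rh-lead g2's ruling R16 of 2026-08-27T01:00:25Z: «if q2-hull's file does not cover row 20′, rp-m1 files that one decl» — abc-iut-rh2-q2-hull's
`Repair/RH2SigmaHullSigmaBinderRefute.lean` (p480214) covers Σ₁₅ / Σ₈ / Σ₁₈ / Σ₁₆ and not Σ₂₀′). TAKES NO SIDE on [IUTchIII] Cor. 3.12 or on any author
(Mochizuki / Scholze–Stix / Joshi / Dupuy–Hilado); what is refuted is a datum-class MEMBERSHIP binder of the cell's OWN typed certificate, at ONE genuine datum;
refuted-as-typed ≠ refuted-in-print; typed ≠ proved; `HStarReachMix` (abc-iut-rh-typ-7, p476752) stays a HYPOTHESIS SHAPE elsewhere, never asserted; nothing here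
asserts abc.

THE ITEM (this seat's kernel caveat R14-bis, probe `HOME/plan/repair/m1/audit-g8/ProbeSigmaBinderVacuity.lean` 2450c2b258aed9c2; concurring file p480214). abc-iut-rh-typ-7's
`RH.LinearReachLaw.abc_of_hStarReachMix_v10K_window_szpiroBadAll` (p477961) is abc-iut-rh2-q2-hull's generic window-shape re-cut `RH2SigmaHull.abc_of_inSigma_v10K_window_szpiroBadAll`
(p475597) at `InSig := HStarReachMix (pilotDataOfK T.D T.K)` with the door `RH.LinearReachLaw.pilotKummerCompatHull_chosen_of_hStarReachMix` (p477961 §1): its Σ-binder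
`hSigma20Bad` «every admissible genuine datum off the depth locus of a SZPIRO-BAD point satisfies H⋆₂₀-MIX» composes with the door into the `hSHwBad` slot of
`Conditional.abc_of_SH_v10K_window_szpiroBadAll` (p453137), and `hSHwBad` is FALSE with NO hypothesis since `Conditional.condP6_thirteen` (p476875;
`Conditional.not_hSHwBad_frey_holds` p477209). In the PARAMETER-FREE currency of p480214:

* `frey13_not_hStarReachMix` — at every genuine datum `T` over `(ratPoint λ, 13)`, `¬ HStarReachMix (pilotDataOfK T.D T.K)`: p480214's `frey13_not_of_door` (w5-d107's
  UNCONDITIONAL `GenuineK.not_pilotKummerCompatHull_chosen_triple_3677_thirteen` at the trivial column family) at abc-iut-rh-typ-7's door;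
* `not_hSigma20Bad` — the Σ-binder of p477961, TYPE VERBATIM (p477961 :204–219), is FALSE: p480214's `not_hSigmaBad_of_forall_not_frey13` at the previous theorem.

READING (numbers, no side). p477961's abc-end is a kernel-true implication with a kernel-false antecedent: VACUOUS AS TYPED — the class of its five hull-lane siblings
(p480214 `not_hSigma15Bad / not_hSigma8Bad / not_hSigma18Bad / not_hSigma16Bad / not_hInSigma16Bad`) and of the `hreg` composites before them (`Conditional.not_hreg_v4`), one
binder over. Its `hNumBad` / `hregBad` are idle. What stands for row 20′ (rh-lead R14-bis board words): the mixed-law door p477348 / p477961 §1 itself, the explicit-2 orNum shape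
(`RH2SigmaHull.abc_of_inSigma_orNum_K_szpiroBad_hregBad` at `InSig := HStarReachMix …`, whose off-Σ binder asks the NUMBER-level `T.Cor312Of` — engaged at `(ratPoint λ, 13)` by
`frey13_not_hStarReachMix`, neither proved nor refuted as typed), and the content-cut line. HONEST SCOPE: SHARP reading of the hull clause (typed (Ind1)/(Ind2)); Σ₂₀′ is this
cell's OWN candidate repair, not anything in print; nothing here bears on the printed GLOBAL inequality, the number-level Corollary, or any author's intended hull.
[cite: Mochizuki2012, IUTchIII Cor. 3.12 p. 173–174, Step (xi-f) p. 184; IUTchIV Thm. 1.10 p. 22–23, Cor. 2.2 (ii) proof (P2)(P5)(P6)(P7) p. 45–47] [cite: DupuyHilado2025, §3.9, §4.9]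
[claim: Mochizuki2012, status: disputed] for every IUT quotation.
-/

noncomputable section
open Set Function
namespace Summit.ABC.IUTFork.Repair.RH.LinearReachLaw

open Thm311 Thm311.Real Cor312 Cor312.Setting Cor312Vol Cor312Prov Literature.IUT.LogThetaLattice Literature.IUT.LogVolume
  Literature.IUT.HodgeTheaters Literature.IUT.LogVolume.ThetaData
open Literature.NumberTheory.NumberFields NumberField IsDedekindDomain Metric Summit.ABC.IUTFork.Repair.RH2SigmaHull
open Literature.NumberTheory.DiophantineGeometry Literature.NumberTheory.DiophantineGeometry.GenEll Summit.ABC.ABC.Theorems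

/-- **OFF Σ₂₀′**: no genuine Θ-volume datum over `(ratPoint λ, 13)` satisfies abc-iut-rh-typ-7's `HStarReachMix (pilotDataOfK T.D T.K)` (p476752) — the conclusion of
`hSigma20Bad` (p477961) at `T`, VERBATIM: abc-iut-rh2-q2-hull's `RH2SigmaHull.frey13_not_of_door` (p480214; abc-iut-w5-d107's UNCONDITIONAL
`GenuineK.not_pilotKummerCompatHull_chosen_triple_3677_thirteen` at the trivial column family) at the door `pilotKummerCompatHull_chosen_of_hStarReachMix` (p477961 §1),
which holds for every column family. `HStarReachMix` stays a HYPOTHESIS SHAPE elsewhere. [cite: Mochizuki2012, IUTchIII Cor. 3.12 Step (xi-f) p. 184]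
[cite: DupuyHilado2025, §3.9, §4.9] [claim: Mochizuki2012, status: disputed] -/
theorem frey13_not_hStarReachMix
    (T : Cor22.ThetaVolumeDatumAt (ratPoint (((2 * 5 ^ 10 * 13 ^ 4 : ℕ) : ℚ) / (11 ^ 8 * 109 ^ 2 * 3677 ^ 3 : ℕ))) 13) :
    letI := T.instFieldF; letI := T.instNumberFieldF; letI := T.instAlgebraF; letI := T.instFieldK
    letI := T.instNumberFieldK; letI := T.instAlgebraK; letI := T.instFieldFbar; letI := T.instAlgebraFbar
    letI := T.instAlgebraKFbar; letI := T.instIsElliptic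
    ¬ HStarReachMix (pilotDataOfK T.D T.K) := by
  letI := T.instFieldF; letI := T.instNumberFieldF; letI := T.instAlgebraF; letI := T.instFieldK
  letI := T.instNumberFieldK; letI := T.instAlgebraK; letI := T.instFieldFbar; letI := T.instAlgebraFbar
  letI := T.instAlgebraKFbar; letI := T.instIsElliptic
  exact frey13_not_of_door T fun M _ _ archPk archSub Ψ act Mmod region frobAdm frobLogvol frobΨ frobMmod unitImage ballImage thetaDiv n _ _ _ lat
      _ _ _ _ _ _ _ _ sig split _ _ _ qData qK h =>
    pilotKummerCompatHull_chosen_of_hStarReachMix T.D M archPk archSub Ψ act Mmod region frobAdm frobLogvol frobΨ frobMmod unitImage ballImage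
      thetaDiv n lat sig split qData qK h

/-- **`¬ hSigma20Bad` (row 20′, tuple reach cell at every prime, Σ₂₀′)** — the stratum binder of abc-iut-rh-typ-7's `abc_of_hStarReachMix_v10K_window_szpiroBadAll`
(p477961), TYPE VERBATIM (p477961 :204–219), is FALSE with NO hypothesis: abc-iut-rh2-q2-hull's `RH2SigmaHull.not_hSigmaBad_of_forall_not_frey13` (p480214; pure
logic on `Conditional.FreyTier1.*` + the theorem `Conditional.condP6_thirteen` p476875) at `frey13_not_hStarReachMix`. Hence that certificate is VACUOUS AS TYPED —
the class of its five hull-lane siblings (p480214) and of the `hreg` composites (`Conditional.not_hreg_v4`); successor shapes: the mixed-law door itself, the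
explicit-2 orNum generic at `InSig := HStarReachMix (pilotDataOfK T.D T.K)`, the content-cut line (rh-lead R14-bis / R16). No side taken on [IUTchIII] Cor. 3.12;
refuted-as-typed ≠ refuted-in-print. [cite: Mochizuki2012, IUTchIV Thm. 1.10 p. 22–23, Cor. 2.2 (ii) p. 45–47] [cite: DupuyHilado2025, §3.9, §4.9] [claim: Mochizuki2012, status: disputed] -/
theorem not_hSigma20Bad :
    ¬ (∀ (P : NFPoint), P ∈ UP → ∀ (l : ℕ), l.Prime → 5 ≤ l →
      Cor22.AdmitsCore P → Cor22.CondP2 P l → Cor22.CondP5 P l → Cor22.CondP6 P l →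
      -- ONLY at SZPIRO-BAD `(P, l)`: elsewhere `T.Cor312Of` is the theorem `Cor22.ThetaVolumeDatumAt.cor312Of_of_szpiro` (abc-iut-c312-d1)
      (((l : ℝ) + 5) / 4 < (Cor22.dmod P : ℝ) ∨
        6 * l * (((l : ℝ) + 5) - 4 * Cor22.dmod P) / (((l : ℝ) + 4) * ((l : ℝ) - 3))
            * (P.logDiff + (1 - 1 / (l : ℝ)) * Cor22.logCondAvoid P {2, l})
          + 6 * l * ((l : ℝ) + 5) / (((l : ℝ) + 4) * ((l : ℝ) - 3)) * Real.log Real.pi < Cor22.logQAvoid P {2, l}) →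
      ∀ (T : Cor22.ThetaVolumeDatumAt P l), letI := T.instFieldF; letI := T.instNumberFieldF; letI := T.instAlgebraF; letI := T.instFieldK;
        letI := T.instNumberFieldK; letI := T.instAlgebraK; letI := T.instFieldFbar; letI := T.instAlgebraFbar;
        letI := T.instAlgebraKFbar; letI := T.instIsElliptic;
      ¬ (∃ (pp : Nat.Primes) (_ : 2 < (pp : ℕ)) (i : Fin (thetaIndex (pilotDataOfK T.D T.K)).lstar)
          (x₀ : (thetaIndex (pilotDataOfK T.D T.K)).Fibre (.inr pp)),
        haveI : Fact (pp : ℕ).Prime := ⟨pp.2⟩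
        ((pp : ℕ) : ℝ) ^ ((((i : ℕ) : ℝ) + 2) * (4 + 2 * Real.logb (pp : ℕ) (Module.finrank ℚ T.K)) + 1) *
          ‖(exists_realising_qIdeles_pilotDataOfK T.D).choose pp x₀‖ ^ (((i : ℕ) + 1) ^ 2 - 1) < 1) →
      HStarReachMix (pilotDataOfK T.D T.K)) :=
  not_hSigmaBad_of_forall_not_frey13 _ fun T => frey13_not_hStarReachMix T

end Summit.ABC.IUTFork.Repair.RH.LinearReachLaw

end
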